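import Literature.IUT.LogVolume.SubThetaFieldUnramified
import Literature.IUT.LogVolume.Theorem110GenuineStepIIDatum
import Literature.IUT.LogVolume.ThetaFieldReadingClosure
import Literature.IUT.LogVolume.ThetaFieldReadingNonvacuity
import Literature.IUT.LogVolume.Theorem110TowerBridge
import Literature.IUT.HodgeTheaters.InitialThetaDataKGaloisProofs
import HarnessLib

/-!
# [IUTchIV] Thm. 1.10, Step (ii) for the tower of a genuine Θ-volume datum in the cell's reading v3:
# `log(𝔡^K) + log(𝔣^K) ≤ log(𝔡^{F_tpd}) + log(𝔣^{F_tpd}) + log(2^13·3^3·5^2) + 2·log(l)` with every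
# ramification/Galois hypothesis DISCHARGED

Mochizuki, *Inter-universal Teichmüller theory IV*, RIMS manuscript (Apr. 2020; = PRIMS **57** (2021)), proof of
Thm. 1.10, Step (ii), p. 24 ("`Gal(F/F_tpd) ↪ GL_2(𝔽_3) × GL_2(𝔽_5) × ℤ/2ℤ`", "the extension `K/F` is tamely
ramified at the primes that do not divide `l`, and we have a natural outer inclusion `Gal(K/F) ↪ GL_2(𝔽_l)`",
"`log(𝔡^K) ≤ … ≤ log(𝔡^{F_tpd}) + log(𝔣^{F_tpd}) + 2·log(l) + 21`"), read directly `F_tpd → K` (cell finding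
F-Sd1g3-1) and for the field of the cell's model reading v3 (abc-iut-plan 2026-08-26T02:33Z; `ThetaFieldReading.lean`):
a genuine Θ-volume datum `T : Cor22.ThetaVolumeDatumAt P l` carries a number field `F ⊇ F_tpd` PINNED by
`Cor22.IsSubThetaField P F` (`F_tpd ⊆ F ⊆ F‡(P) = F_tpd(√−1, √λ, √(λ−1), E_λ[15])`, `[F‡(P):F_tpd] ∣ 2²·46080 =
2^{12}·3²·5`, abc-iut-L5-t7 `finrank_thetaClosureField_dvd`), an elliptic curve `E/F` with `j(E) = j(λ)` and initial
Θ-data `D : InitialThetaData F K F̄ E l Pb` ([IUTchI] Def. 3.1: `E` semistable, `F/F_mod` Galois, `K ⊆ F̄` cut out by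
`ker(G_F → GL₂(𝔽_l))`). THIS FILE proves, for exactly such data, the `K`-level Step (ii) bound of abc-iut-L5-t15's
`Cor22.ndeg_differentDivisor_add_logCondOver_le_pow` (exponent `a = 12`, constant `log(2^13·3^3·5^2) + 2·log l`,
still `≤ 2·log l + 21`) with all six hypotheses discharged:

* generic-curve `K`-layer (Prop. 1.8 (vii) instance forms for ANY semistable `E/F` with `j(E) = j(λ)` and any
  `K ⊆ F(E[l])` Galois over `F`): `one_lt_valuation_j_iff_of_j_eq`, `hasGoodReductionAt_of_isSemistable_of_j_eq`,
  `hasMultiplicativeReductionAt_of_isSemistable_of_j_eq`, `ramificationIdx_eq_one_of_ker_le`,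
  `exists_ramificationIdx_eq_pow_of_ker_le`, `not_dvd_ramificationIdx_of_ker_le`, `finrank_dvd_of_ker_le`;
* `F`-layer: `hFgood` = `ramificationIdx_subThetaField_eq_one` (`SubThetaFieldUnramified.lean`), `hdegF` from
  `IsSubThetaField.finrank_dvd` + `finrank_thetaClosureField_dvd`, `hFtame` from `e ∣ [F:F_tpd]`;
  `isGalois_tpd_of_isGalois_fieldOfModuli` — `F/F_tpd` is Galois because `F/F_mod` is (Def. 3.1 (b)) and
  `F_mod = ℚ(j(λ)) ⊆ F_tpd`;
* **`ndeg_differentDivisor_add_logCondOver_le_pinned`**, **`logDiff_le_pinned`** — the bounds for the datum's tower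
  (apply to `T.F, T.K, T.Fbar, T.E, T.D, T.j_eq, T.isSubThetaField`).

Theorems only; classical algebraic number theory (torsion fields of elliptic curves with `j = j(λ)`); TAKES NO SIDE
on [IUTchIII] Cor. 3.12.
-/

noncomputable section

open scoped Classical

namespace Literature.IUT.LogVolume

namespace Cor22

open NumberField IsDedekindDomain Literature.NumberTheory.DiophantineGeometry.GenEll
open Literature.NumberTheory.EllipticCurves Literature.NumberTheory.NumberFields Literature.IUT.HodgeTheaters
open WeierstrassCurve IntermediateField Field

/-! ## The `K/F` layer for ANY curve `E/F` with `j(E) = j(λ)` -/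

section GenericCurve

variable {P : NFPoint} (F : Type) [Field F] [NumberField F] [Algebra P.F F] {E : WeierstrassCurve F}
  [hE : E.IsElliptic]

/-- `|j(E)|_w > 1` iff the place of `F_tpd` under `w` is a bad place of `λ`, when `j(E) = j(λ)`.
[cite: Mochizuki2012, IUTchIV Thm 1.10 p.22] -/
theorem one_lt_valuation_j_iff_of_j_eq (hj : E.j = algebraMap P.F F (jInv P.x)) (w : HeightOneSpectrum (𝓞 F)) :
    1 < w.valuation F E.j ↔ finBelow P.F F w ∈ badPlaces P := by
  letI : Algebra P.F (extend P F).F := ‹Algebra P.F F›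
  refine Iff.trans ?_ (mem_badPlaces_iff_of_algebraMap (P := P) (Q := extend P F) rfl w)
  rw [hj, jInv_map]
  unfold badPlaces
  rw [Set.Finite.mem_toFinset]
  rfl

/-- **A semistable `E/F` with `j(E) = j(λ)` has good reduction over the good places of `λ`.**
[cite: Mochizuki2012, IUTchIV Thm 1.10 p.22] [cite: SilvermanAEC2009, Prop. VII.5.1] -/
theorem hasGoodReductionAt_of_isSemistable_of_j_eq (hss : E.IsSemistable (𝓞 F))
    (hj : E.j = algebraMap P.F F (jInv P.x)) (w : HeightOneSpectrum (𝓞 F))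
    (hw : finBelow P.F F w ∉ badPlaces P) : E.HasGoodReductionAt w := by
  rcases hss w with hgood | hmult
  · exact hgood
  · exfalso
    exact hw ((one_lt_valuation_j_iff_of_j_eq F hj w).1
      (one_lt_valuation_j_of_hasMultiplicativeReduction_localMinimalModel w E hmult))

/-- **A semistable `E/F` with `j(E) = j(λ)` has multiplicative reduction over the bad places of `λ`.**
[cite: Mochizuki2012, IUTchIV Cor 2.2 (ii) proof (P5) p.46] [cite: SilvermanAEC2009, Prop. VII.5.1] -/
theorem hasMultiplicativeReductionAt_of_isSemistable_of_j_eq (hss : E.IsSemistable (𝓞 F))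
    (hj : E.j = algebraMap P.F F (jInv P.x)) (w : HeightOneSpectrum (𝓞 F))
    (hw : finBelow P.F F w ∈ badPlaces P) : E.HasMultiplicativeReductionAt w := by
  rcases hss w with hgood | hmult
  · exfalso
    have h1 := valuation_j_le_one_of_hasGoodReduction_localMinimalModel w E hgood
    exact absurd ((one_lt_valuation_j_iff_of_j_eq F hj w).2 hw) (not_lt.2 h1)
  · exact hmult

variable {F}
variable {K : Type} [Field K] [NumberField K] [Algebra F K] (ψ : K →ₐ[F] AlgebraicClosure F)

/-- **`K/F` unramified at the good places `w ∤ l`** for `K ⊆ F(E[l])` Galois over `F` (Prop. 1.8 (vii), first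
sentence; instance form for any semistable `E` with `j(E) = j(λ)`). [cite: Mochizuki2012, IUTchIV Prop 1.8 (vii) p.19]
[cite: SilvermanAEC2009, Prop. VII.4.1(a)] -/
theorem ramificationIdx_eq_one_of_ker_le (hss : E.IsSemistable (𝓞 F)) (hj : E.j = algebraMap P.F F (jInv P.x))
    [IsGalois F K] {l : ℕ} (hK : (E.galoisRepTorsion (l : ℤ)).ker ≤ ψ.fieldRange.fixingSubgroup)
    (u : HeightOneSpectrum (𝓞 K)) (hlu : ((l : ℕ) : 𝓞 F) ∉ (finBelow F K u).asIdeal)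
    (hgood : finBelow P.F F (finBelow F K u) ∉ badPlaces P) : u.asIdeal.ramificationIdx (𝓞 F) = 1 := by
  haveI : FiniteDimensional F K := Module.Finite.of_restrictScalars_finite ℚ F K
  let e : K ≃ₐ[F] ψ.fieldRange :=
    ((IntermediateField.topEquiv (F := F) (E := K)).symm.trans (IntermediateField.equivMap ⊤ ψ)).trans
      (IntermediateField.equivOfEq (AlgHom.fieldRange_eq_map ψ).symm)
  haveI : FiniteDimensional F ψ.fieldRange := LinearEquiv.finiteDimensional e.toLinearEquiv
  haveI : IsGalois F ψ.fieldRange := IsGalois.of_algEquiv e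
  haveI : NumberField ψ.fieldRange := NumberField.of_module_finite F ψ.fieldRange
  set Q : Ideal (𝓞 ψ.fieldRange) :=
    u.asIdeal.map (RingOfIntegers.mapAlgEquiv e : 𝓞 K ≃ₐ[𝓞 F] 𝓞 ψ.fieldRange) with hQ
  haveI : Q.IsPrime := isPrime_map_mapAlgEquiv e u
  haveI : Q.LiesOver (finBelow F K u).asIdeal := liesOver_map_mapAlgEquiv e u _
  rw [← ramificationIdx_map_mapAlgEquiv e u]
  exact E.ramificationIdx_divisionField_eq_one_of_hasGoodReductionAt ψ.fieldRange hK
    (hasGoodReductionAt_of_isSemistable_of_j_eq F hss hj _ hgood) (by exact_mod_cast hlu) Q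

/-- **`e(u|w)` is a power of `l` at every place `w ∤ l`** for `K ⊆ F(E[l])` Galois over `F`, `l` prime (Prop. 1.8
(vii): `1` at good places, a power of `l` at multiplicative ones). [cite: Mochizuki2012, IUTchIV Prop 1.8 (vii) p.19] -/
theorem exists_ramificationIdx_eq_pow_of_ker_le (hss : E.IsSemistable (𝓞 F))
    (hj : E.j = algebraMap P.F F (jInv P.x)) [IsGalois F K] {l : ℕ} (hl : l.Prime)
    (hK : (E.galoisRepTorsion (l : ℤ)).ker ≤ ψ.fieldRange.fixingSubgroup)
    (u : HeightOneSpectrum (𝓞 K)) (hlu : ((l : ℕ) : 𝓞 F) ∉ (finBelow F K u).asIdeal) :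
    ∃ k : ℕ, u.asIdeal.ramificationIdx (𝓞 F) = l ^ k := by
  by_cases hgood : finBelow P.F F (finBelow F K u) ∉ badPlaces P
  · exact ⟨0, by rw [pow_zero]; exact ramificationIdx_eq_one_of_ker_le ψ hss hj hK u hlu hgood⟩
  rw [not_not] at hgood
  haveI : FiniteDimensional F K := Module.Finite.of_restrictScalars_finite ℚ F K
  let e : K ≃ₐ[F] ψ.fieldRange :=
    ((IntermediateField.topEquiv (F := F) (E := K)).symm.trans (IntermediateField.equivMap ⊤ ψ)).trans
      (IntermediateField.equivOfEq (AlgHom.fieldRange_eq_map ψ).symm)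
  haveI : FiniteDimensional F ψ.fieldRange := LinearEquiv.finiteDimensional e.toLinearEquiv
  haveI : IsGalois F ψ.fieldRange := IsGalois.of_algEquiv e
  haveI : NumberField ψ.fieldRange := NumberField.of_module_finite F ψ.fieldRange
  set Q : Ideal (𝓞 ψ.fieldRange) :=
    u.asIdeal.map (RingOfIntegers.mapAlgEquiv e : 𝓞 K ≃ₐ[𝓞 F] 𝓞 ψ.fieldRange) with hQ
  haveI : Q.IsPrime := isPrime_map_mapAlgEquiv e u
  haveI : Q.LiesOver (finBelow F K u).asIdeal := liesOver_map_mapAlgEquiv e u _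
  rw [← ramificationIdx_map_mapAlgEquiv e u]
  exact E.exists_ramificationIdx_divisionField_eq_pow_of_hasMultiplicativeReductionAt hl ψ.fieldRange hK
    (hasMultiplicativeReductionAt_of_isSemistable_of_j_eq F hss hj _ hgood) (by exact_mod_cast hlu) Q

/-- **No prime `p ≠ l` divides `e(u|w)` at a place `w ∤ l`** ("`K/F` is tamely ramified at the primes that do
not divide `l`", Step (ii) p. 24). [cite: Mochizuki2012, IUTchIV Thm 1.10 proof Step (ii) p.24] -/
theorem not_dvd_ramificationIdx_of_ker_le (hss : E.IsSemistable (𝓞 F)) (hj : E.j = algebraMap P.F F (jInv P.x))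
    [IsGalois F K] {l : ℕ} (hl : l.Prime) (hK : (E.galoisRepTorsion (l : ℤ)).ker ≤ ψ.fieldRange.fixingSubgroup)
    (u : HeightOneSpectrum (𝓞 K)) (hlu : ((l : ℕ) : 𝓞 F) ∉ (finBelow F K u).asIdeal) {p : ℕ} (hp : p.Prime)
    (hpl : p ≠ l) : ¬ p ∣ u.asIdeal.ramificationIdx (𝓞 F) := by
  obtain ⟨k, hk⟩ := exists_ramificationIdx_eq_pow_of_ker_le ψ hss hj hl hK u hlu
  rw [hk]
  intro h
  exact hpl ((Nat.prime_dvd_prime_iff_eq hp hl).mp (hp.dvd_of_dvd_pow h))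

omit [NumberField K] in
/-- **"`Gal(K/F) ↪ GL_2(𝔽_l)`"**: `[K:F] ∣ l·(l−1)²·(l+1)` for `K ⊆ F(E[l])`.
[cite: Mochizuki2012, IUTchIV Thm 1.10 proof Step (ii) p.24] [cite: Serre1972, §4.1] -/
theorem finrank_dvd_of_ker_le {l : ℕ} [Fact l.Prime] (hK : (E.galoisRepTorsion (l : ℤ)).ker ≤ ψ.fieldRange.fixingSubgroup) :
    Module.finrank F K ∣ l * (l - 1) ^ 2 * (l + 1) := by
  let e : K ≃ₐ[F] ψ.fieldRange :=
    ((IntermediateField.topEquiv (F := F) (E := K)).symm.trans (IntermediateField.equivMap ⊤ ψ)).trans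
      (IntermediateField.equivOfEq (AlgHom.fieldRange_eq_map ψ).symm)
  rw [e.toLinearEquiv.finrank_eq]
  exact E.finrank_dvd_of_ker_galoisRepTorsion_le_fixingSubgroup l ψ.fieldRange hK

end GenericCurve

/-! ## `F/F_tpd` is Galois for initial Θ-data whose curve has `j = j(λ)` -/

section Galois

variable {P : NFPoint} {F : Type} [Field F] [NumberField F] [Algebra P.F F] {E : WeierstrassCurve F} [E.IsElliptic]

/-- **`F/F_tpd` is Galois when `F/F_mod` is** ([IUTchI] Def. 3.1 (b) "the field extension `F/F_mod` is Galois") and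
`j(E) = j(λ)`: then `F_mod = ℚ(j(E)) = ℚ(j(λ))` lies in the image of `F_tpd = P.F`, and a Galois extension is Galois
over every intermediate field. [claim: Mochizuki2012, status: disputed] -/
theorem isGalois_tpd_of_isGalois_fieldOfModuli (hj : E.j = algebraMap P.F F (jInv P.x))
    [hG : IsGalois (fieldOfModuli E) F] : IsGalois P.F F := by
  -- `F_mod = (ℚ(j(λ)) ⊆ F_tpd).map (F_tpd → F)`
  let φ : P.F →ₐ[ℚ] F := IsScalarTower.toAlgHom ℚ P.F F
  set M₀ : IntermediateField ℚ P.F := IntermediateField.adjoin ℚ {jInv P.x} with hM₀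
  have hfm : fieldOfModuli E = M₀.map φ := by
    rw [fieldOfModuli, hj, hM₀, IntermediateField.adjoin_map, Set.image_singleton]
    rfl
  let e : M₀ ≃ₐ[ℚ] fieldOfModuli E :=
    (IntermediateField.equivMap M₀ φ).trans (IntermediateField.equivOfEq hfm.symm)
  -- the `F_mod`-algebra structure on `F_tpd` through `e⁻¹`
  letI : Algebra (fieldOfModuli E) P.F :=
    ((M₀.val : M₀ →ₐ[ℚ] P.F).comp (e.symm : fieldOfModuli E →ₐ[ℚ] M₀)).toRingHom.toAlgebra
  haveI : IsScalarTower (fieldOfModuli E) P.F F := by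
    refine IsScalarTower.of_algebraMap_eq fun y => ?_
    -- `y = e x` with `x ∈ M₀`: `algebraMap F_mod F y = y = φ x = algebraMap F_tpd F (algebraMap F_mod F_tpd y)`
    obtain ⟨x, rfl⟩ := e.surjective y
    change ((e x : fieldOfModuli E) : F) = algebraMap P.F F ((M₀.val : M₀ →ₐ[ℚ] P.F) (e.symm (e x)))
    rw [e.symm_apply_apply]
    change ((e x : fieldOfModuli E) : F) = φ (x : P.F)
    rfl
  exact IsGalois.tower_top_of_isGalois (fieldOfModuli E) P.F F

end Galois

/-! ## Step (ii) for the tower of a v3 genuine Θ-volume datum -/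

section Pinned

variable {P : NFPoint} {F : Type} [Field F] [NumberField F] [Algebra P.F F]
  {K : Type} [Field K] [NumberField K] [Algebra F K] [Algebra P.F K] [IsScalarTower P.F F K]
  {Fbar : Type} [Field Fbar] [Algebra F Fbar] [Algebra K Fbar]
  {E : WeierstrassCurve F} [hE : E.IsElliptic] {l : ℕ} {Pb : BadPlacePredicates K}

/-- **[IUTchIV] Thm. 1.10, Step (ii) for the tower `F_tpd ⊆ F ⊆ K` of a genuine Θ-volume datum (reading v3),
every hypothesis discharged**: for `λ ∈ U_X`, a field `F` pinned by `IsSubThetaField P F`, an elliptic curve `E/F`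
with `j(E) = j(λ)`, initial Θ-data `D` over `E` with prime `l ≥ 7`:
`log(𝔡^K) + log(𝔣^K) ≤ log(𝔡^{F_tpd}) + log(𝔣^{F_tpd}) + log(2^13·3^3·5^2) + 2·log(l)`
(abc-iut-L5-t15's `ndeg_differentDivisor_add_logCondOver_le_pow` at `a = 12`: `[F:F_tpd] ∣ [F‡(P):F_tpd] ∣
2²·46080`; `hFgood` = `ramificationIdx_subThetaField_eq_one`; `hKgood/hKbad/hdegK` from the generic-curve
`K`-layer over the embedding `K → F̄ ≅ AlgebraicClosure F` of `Theorem110GenuineStepIIDatum`).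
[claim: Mochizuki2012, status: disputed] -/
theorem ndeg_differentDivisor_add_logCondOver_le_pinned (hU : P.InU) (hF : IsSubThetaField P F)
    (hj : E.j = algebraMap P.F F (jInv P.x)) (D : InitialThetaData F K Fbar E l Pb) (h7 : 7 ≤ l) :
    ndeg K (differentDivisor K) + logCondOver P {2, l} K ≤
      P.logDiff + logCondAvoid P {2, l} + (Real.log (2 ^ (12 + 1) * 3 ^ 3 * 5 ^ 2) + 2 * Real.log l) := by
  have hl : l.Prime := D.l_prime
  haveI : Fact l.Prime := ⟨hl⟩
  haveI := D.isScalarTower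
  haveI := D.isAlgClosure
  haveI := D.isGalois_fieldOfModuli
  haveI : IsGalois P.F F := isGalois_tpd_of_isGalois_fieldOfModuli hj
  haveI : IsGalois F K := isGalois_F_K_of_initialThetaData D
  -- the embedding `K → AlgebraicClosure F` inside the `l`-division field
  let ι : Fbar ≃ₐ[F] AlgebraicClosure F := IsAlgClosure.equiv F Fbar (AlgebraicClosure F)
  let ψ : K →ₐ[F] AlgebraicClosure F :=
    (ι : Fbar →ₐ[F] AlgebraicClosure F).comp (IsScalarTower.toAlgHom F K Fbar)
  have hK : (E.galoisRepTorsion (l : ℤ)).ker ≤ ψ.fieldRange.fixingSubgroup :=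
    ker_galoisRepTorsion_le_fixingSubgroup_of_initialThetaData D ι
  have hss : E.IsSemistable (𝓞 F) := D.isSemistable
  -- degrees
  have hdegF : Module.finrank P.F F ∣ 2 ^ 12 * 3 ^ 2 * 5 := by
    haveI : Fact P.InU := ⟨hU⟩
    have h1 := hF.finrank_dvd (subThetaFieldGenerators_splits_thetaClosureField P hU)
    have h2 := finrank_thetaClosureField_dvd P hU
    have h := h1.trans h2
    norm_num at h ⊢
    exact h
  refine ndeg_differentDivisor_add_logCondOver_le_pow P hl h7 12 F K hdegF (finrank_dvd_of_ker_le ψ hK)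
    ?_ ?_ ?_ ?_
  · intro u hu hgood
    refine ramificationIdx_eq_one_of_ker_le ψ hss hj hK u
      (natCast_notMem_finBelow_of_residueChar_ne hl u hu) ?_
    rwa [finBelow_finBelow P.F F K u]
  · intro u hu _
    exact not_dvd_ramificationIdx_of_ker_le ψ hss hj hl hK u
      (natCast_notMem_finBelow_of_residueChar_ne hl u hu) (residueChar_prime K u) hu
  · intro w hw hgood
    exact ramificationIdx_subThetaField_eq_one F hU hF w (thirty_notMem_finBelow_of_residueChar_notMem w hw) hgood
  · intro w hw
    simp only [Finset.mem_insert, Finset.mem_singleton, not_or] at hw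
    obtain ⟨h2, h3, h5⟩ := hw
    haveI := w.isPrime
    haveI : (finBelow P.F F w).asIdeal.IsMaximal := (finBelow P.F F w).isMaximal
    intro h
    have h' := (h.trans (ramificationIdx_dvd_finrank_of_isGalois (finBelow P.F F w).asIdeal w.asIdeal)).trans hdegF
    have hp := residueChar_prime F w
    have h235 : (2 ^ 12 * 3 ^ 2 * 5 : ℕ) = (2 ^ 12 * 3 ^ 2) * 5 := by norm_num
    rcases (Nat.Prime.dvd_mul hp).1 h' with h23 | h5'
    · rcases (Nat.Prime.dvd_mul hp).1 h23 with h2' | h3'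
      · exact h2 ((Nat.prime_dvd_prime_iff_eq hp Nat.prime_two).1 (hp.dvd_of_dvd_pow h2'))
      · exact h3 ((Nat.prime_dvd_prime_iff_eq hp Nat.prime_three).1 (hp.dvd_of_dvd_pow h3'))
    · exact h5 ((Nat.prime_dvd_prime_iff_eq hp (by norm_num)).1 h5')

/-- **`log(𝔡^K) ≤ log(𝔡^{F_tpd}) + log(𝔣^{F_tpd}) + 2·log(l) + 21` for the tower of every genuine Θ-volume datum
(reading v3)** — the printed `K`-level different bound of Step (ii) (p. 24), the quantity Steps (iii), (v), (viii)
consume, with `log(2^13·3^3·5^2) ≤ 21` absorbing the two extra quadratic layers of the pinned field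
(abc-iut-S3's `log_two_pow_thirteen_mul_le`). [claim: Mochizuki2012, status: disputed] -/
theorem logDiff_le_pinned (hU : P.InU) (hF : IsSubThetaField P F) (hj : E.j = algebraMap P.F F (jInv P.x))
    (D : InitialThetaData F K Fbar E l Pb) (h7 : 7 ≤ l) :
    (extend P K).logDiff ≤ P.logDiff + logCondAvoid P {2, l} + 2 * Real.log l + 21 := by
  have h := ndeg_differentDivisor_add_logCondOver_le_pinned hU hF hj D h7
  have hK' : (extend P K).logDiff = ndeg K (differentDivisor K) :=
    logDiff_eq_ndeg_differentDivisor (extend P K)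
  have h0 : 0 ≤ logCondOver P {2, l} K := logCondOver_nonneg P {2, l} K
  have h21 : Real.log (2 ^ (12 + 1) * 3 ^ 3 * 5 ^ 2 : ℝ) ≤ 21 := by
    have := log_two_pow_thirteen_mul_le
    norm_num at this ⊢
    exact this
  rw [hK']
  linarith

end Pinned

end Cor22

end Literature.IUT.LogVolume

end
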